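import Literature.Geometry.DiscreteGeometry.ContactGraphBoundaryCycle
import Literature.Geometry.DiscreteGeometry.UnitDiscFanCycle
import Literature.Geometry.DiscreteGeometry.HarborthConstruction
import HarnessLib

/-!
# Heitmann–Radin 1980, Theorem (2)(a): ground states of sticky discs lie on the triangular lattice

Topic `Literature/Geometry/DiscreteGeometry`. Discharge of the named fact
`HeitmannRadin1980_groundStates` of `UnitDiscContactNumber.lean`: every maximal configuration of
`N ≥ 3` unit discs (= ground state of `N` sticky discs) has all its centres on ONE congruent copy
of the triangular lattice `A₂ = {m + n e^{iπ/3}}` [HeitmannRadin1980, Theorem (2)(a), p. 284].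

## The printed proof and its rendering here

Heitmann–Radin (p. 286): "The essence of our method for proving part (2) is that inequalities (4)
[`C_b ≤ 3n - a - 3`, equality iff all faces are triangles] and (6) [`3a - 6 ≥ k₂ + 2k₃ + 3k₄ + 4k₅`,
equality iff every interior angle of `∂C_g` is `(j-1)π/3`] cannot both be strict; if they were,
one could obtain (8), and then (9), with `B(n)` replaced by `{B(n) + 1}`, which of course would be
false. Assume `n` is the smallest nonnegative integer for which there exists a maximal
configuration `C` such that `f_j ≠ 0` for some `j ≥ 4` […] `(C_b + 1) ≤ 3n - a - 3` (4̃′) […] Since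
by assumption there is a nontriangle in `C_g`, either it touches `∂C_g` or it lies in `C_g'`. In
the former case we get a strict inequality from (6), which leads to `(C_b + 1) ≤ C_b' + 3a - 6`
(7′) and then, using `C_b' ≤ B(n - a)`, to (8′). If the latter were the case, then by the
minimality of `n` we have `C_b' ≤ B(n - a) - 1`, and again we have (8′) […] `(C_b + 1) ≤
3n - (12n - 3)^{1/2}`, which is in contradiction with the maximality of `C`."

The tree's proof of Harborth's bound (`HarborthInduction.lean` … `ContactGraphBoundaryCycle.lean`)
is Euler-free: faces never appear, (4) comes from "every disc touches at most six others" and the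
boundary inequality `∑_{∂} deg ≤ 4a - 6`. Accordingly "all faces are triangles" is rendered by
its local trace: every CORNER (dart `(q, p)`, read as the angular gap at `p` following the bond
to `q`, `Harborth.gapAngle`) is either TIGHT (angle exactly `π/3`) or one of the `a` OUTER
corners traced by the boundary walk (`Harborth.traceDart`). With the one-vertex lemmas of
`UnitDiscFanCycle.lean` the printed argument goes through word for word:

* §1 arithmetic: `[3n - √(12n-3)]` is STRICTLY superadditive across a shared disc and strictly
  increasing, so a maximal configuration does not split (Heitmann–Radin p. 284: "From the maximal
  property of `C` it follows that `C_g` is a connected set and furthermore that this property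
  would persist in the configuration obtained by removing any one disk") — `not_splits_of_maximal`;
  the number of darts is even.
* §2 "strict inequality from (6)": a non-tight non-outer corner at a boundary vertex gives
  `∑_{∂} deg ≤ 4a - 7` (`sum_card_nbrs_bdrySet_le_of_ne`).
* §3 THE INDUCTION `tight_or_outer_of_maximal` (strong induction on `n`, as printed): a non-tight
  corner at a boundary vertex gives (4̃′) and (7′) by parity, hence (8′) by the tree's peel step —
  contradiction; a non-tight corner at an interior vertex gives (4̃′) (that vertex has `≤ 5`
  neighbours); if (7′) fails, the boundary carries exactly `3a - 6` bonds and the interior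
  configuration `C'` is maximal ("by the minimality of `n`" = the induction hypothesis): the face
  walk of the wide corner avoids the boundary (its corners are all wide, `UnitDiscFanCycle`), so it
  survives in `C'` with the same angles, and by the induction hypothesis it is `C'`'s outer
  boundary; but then no disc of `C'` can touch a boundary disc of `C` (every direction at a disc of
  `C'` lies in a tight corner or in that walk's corner, both of which exclude a further bond) —
  `C` would split. This last step is where "the nontriangle lies in `C_g'`" is used without faces.
* §4 tight-or-outer everywhere + connectedness ⇒ all bond vectors lie in `u·{ζ^j}` for one unit
  `u` (`ζ = e^{iπ/3}`), so all centres lie in `t + u(ℤ + ℤζ)` (`exists_lattice_of_tight`).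
* §5 transfer to the fact's rendering (`Fin N → EuclideanSpace ℝ (Fin 2)`, `IsMaximalDiscConfig`,
  `Theil2006.triPoint`) and `HeitmannRadin1980_groundStates_holds`.

What is NOT proved here (and not claimed by the named fact): the polygon form of (2)(a) ("`C_v`
consists of all the lattice points inside and on this polygon") and (2)(b).
-/

noncomputable section

namespace Literature.Geometry.DiscreteGeometry

namespace Harborth

open Complex Finset
open Literature.Topology.PlaneTopology
open scoped Real

variable {P : Finset ℂ}

/-! ## §1 Arithmetic: strictness in Harborth's number; parity of darts; maximal ⇒ no split -/

/-- `√X ≤ N` from `X ≤ N²`, `N ≥ 0`. [folklore] -/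
private theorem sqrt_le_of_le_sq' {X N : ℝ} (hN : 0 ≤ N) (h : X ≤ N ^ 2) : Real.sqrt X ≤ N := by
  rw [← Real.sqrt_sq hN]
  exact Real.sqrt_le_sqrt h

/-- Harborth's number as `3n - ⌈√(12n - 3)⌉`. [cite: Harborth1974, (5)] -/
theorem harborthNumber_eq_sub_ceil (n : ℕ) :
    harborthNumber n = 3 * n - ⌈Real.sqrt (12 * n - 3)⌉ := by
  rw [harborthNumber, show (3 * n : ℝ) - Real.sqrt (12 * n - 3) = -Real.sqrt (12 * n - 3) + (3 * n : ℤ)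
    by push_cast; ring, Int.floor_add_intCast, Int.floor_neg]
  ring

/-- **Strict monotonicity**: `[3n - √(12n-3)] < [3(n+1) - √(12(n+1)-3)]` for `n ≥ 1` (adding a
disc touching one other adds a contact). [cite: Harborth1974, (5)] -/
theorem harborthNumber_lt_succ {n : ℕ} (hn : 1 ≤ n) : harborthNumber n < harborthNumber (n + 1) := by
  rw [harborthNumber_eq_floor, harborthNumber_eq_floor]
  have key : harborthReal n + 1 ≤ harborthReal (n + 1) := by
    unfold harborthReal
    push_cast
    have hn' : (1 : ℝ) ≤ n := by exact_mod_cast hn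
    set s := Real.sqrt (12 * n - 3) with hs
    have hs0 : 0 ≤ 12 * (n : ℝ) - 3 := by linarith
    have hsq : s ^ 2 = 12 * n - 3 := Real.sq_sqrt hs0
    have hs3 : 3 ≤ s := (Real.le_sqrt (by norm_num) hs0).2 (by linarith)
    have : Real.sqrt (12 * (n + 1 : ℝ) - 3) ≤ s + 2 := sqrt_le_of_le_sq' (by linarith) (by nlinarith)
    linarith
  have := Int.floor_le_floor key
  rw [Int.floor_add_one] at this
  omega

/-- **Strict superadditivity across a shared disc**: for `m₁, m₂ ≥ 1`,
`[f(m₁+1)] + [f(m₂+1)] < [f(m₁+m₂+1)]`, `f(n) = 3n - √(12n-3)`. With `gᵢ = ⌈√(12mᵢ+9)⌉ ≥ 5` this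
is `⌈√(12(m₁+m₂)+9)⌉ ≤ g₁ + g₂ - 4`, which follows from `12(m₁+m₂)+9 ≤ g₁² + g₂² - 9 ≤ (g₁+g₂-4)²`
when `g₁, g₂ ≥ 6`, and from a direct check when `gᵢ = 5` (`mᵢ = 1`). So a maximal configuration
has no cut disc. [cite: HeitmannRadin1980, §4 (p. 284)] -/
theorem harborthNumber_add_lt {m₁ m₂ : ℕ} (h₁ : 1 ≤ m₁) (h₂ : 1 ≤ m₂) :
    harborthNumber (m₁ + 1) + harborthNumber (m₂ + 1) < harborthNumber (m₁ + m₂ + 1) := by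
  rw [harborthNumber_eq_sub_ceil, harborthNumber_eq_sub_ceil, harborthNumber_eq_sub_ceil]
  push_cast
  have e1 : (12 * (m₁ + 1 : ℝ) - 3) = 12 * m₁ + 9 := by ring
  have e2 : (12 * (m₂ + 1 : ℝ) - 3) = 12 * m₂ + 9 := by ring
  have e3 : (12 * (m₁ + m₂ + 1 : ℝ) - 3) = 12 * m₁ + 12 * m₂ + 9 := by ring
  rw [e1, e2, e3]
  set g₁ := ⌈Real.sqrt (12 * m₁ + 9)⌉ with hg₁
  set g₂ := ⌈Real.sqrt (12 * m₂ + 9)⌉ with hg₂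
  have hm₁ : (1 : ℝ) ≤ m₁ := by exact_mod_cast h₁
  have hm₂ : (1 : ℝ) ≤ m₂ := by exact_mod_cast h₂
  -- `12 mᵢ + 9 ≤ gᵢ²` and `gᵢ ≥ 5`
  have hsq₁ : (12 * m₁ + 9 : ℝ) ≤ (g₁ : ℝ) ^ 2 := by
    have h0 : (0 : ℝ) ≤ 12 * m₁ + 9 := by linarith
    have := Int.le_ceil (Real.sqrt (12 * m₁ + 9))
    rw [← hg₁] at this
    nlinarith [Real.sq_sqrt h0, Real.sqrt_nonneg (12 * (m₁ : ℝ) + 9)]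
  have hsq₂ : (12 * m₂ + 9 : ℝ) ≤ (g₂ : ℝ) ^ 2 := by
    have h0 : (0 : ℝ) ≤ 12 * m₂ + 9 := by linarith
    have := Int.le_ceil (Real.sqrt (12 * m₂ + 9))
    rw [← hg₂] at this
    nlinarith [Real.sq_sqrt h0, Real.sqrt_nonneg (12 * (m₂ : ℝ) + 9)]
  have hg₁5 : 5 ≤ g₁ := by
    have : (4 : ℝ) < Real.sqrt (12 * m₁ + 9) :=
      (Real.lt_sqrt (by norm_num)).2 (by nlinarith)
    have := Int.lt_ceil.2 (show ((4 : ℤ) : ℝ) < Real.sqrt (12 * m₁ + 9) by exact_mod_cast this)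
    omega
  have hg₂5 : 5 ≤ g₂ := by
    have : (4 : ℝ) < Real.sqrt (12 * m₂ + 9) :=
      (Real.lt_sqrt (by norm_num)).2 (by nlinarith)
    have := Int.lt_ceil.2 (show ((4 : ℤ) : ℝ) < Real.sqrt (12 * m₂ + 9) by exact_mod_cast this)
    omega
  -- it suffices to bound the big ceiling by `g₁ + g₂ - 4`
  suffices key : ⌈Real.sqrt (12 * m₁ + 12 * m₂ + 9)⌉ ≤ g₁ + g₂ - 4 by
    have := (Int.cast_le (R := ℝ)).2 key
    push_cast at this
    linarith
  apply Int.ceil_le.2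
  have hN : (0 : ℝ) ≤ ((g₁ + g₂ - 4 : ℤ) : ℝ) := by
    have : (0 : ℤ) ≤ g₁ + g₂ - 4 := by omega
    exact_mod_cast this
  apply sqrt_le_of_le_sq' hN
  push_cast
  -- case analysis on whether some `gᵢ = 5`
  by_cases h6 : 6 ≤ g₁ ∧ 6 ≤ g₂
  · have h6₁ : (6 : ℝ) ≤ g₁ := by exact_mod_cast h6.1
    have h6₂ : (6 : ℝ) ≤ g₂ := by exact_mod_cast h6.2
    nlinarith
  · -- one of them is `5`, so the corresponding `mᵢ = 1`
    rw [not_and_or] at h6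
    rcases h6 with h5 | h5
    · have hg : g₁ = 5 := by omega
      have hm : m₁ = 1 := by
        have : (12 * m₁ + 9 : ℝ) ≤ 25 := by rw [hg] at hsq₁; norm_num at hsq₁; linarith
        have : (m₁ : ℝ) ≤ 4 / 3 := by linarith
        have : m₁ < 2 := by exact_mod_cast (show (m₁ : ℝ) < 2 by linarith)
        omega
      subst hm
      rw [hg]
      push_cast
      by_cases h6' : 6 ≤ g₂
      · have h6₂ : (6 : ℝ) ≤ g₂ := by exact_mod_cast h6'
        nlinarith
      · have hg' : g₂ = 5 := by omega
        have hm' : m₂ = 1 := by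
          have : (12 * m₂ + 9 : ℝ) ≤ 25 := by rw [hg'] at hsq₂; norm_num at hsq₂; linarith
          have : (m₂ : ℝ) ≤ 4 / 3 := by linarith
          have : m₂ < 2 := by exact_mod_cast (show (m₂ : ℝ) < 2 by linarith)
          omega
        subst hm'
        rw [hg']
        norm_num
    · have hg : g₂ = 5 := by omega
      have hm : m₂ = 1 := by
        have : (12 * m₂ + 9 : ℝ) ≤ 25 := by rw [hg] at hsq₂; norm_num at hsq₂; linarith
        have : (m₂ : ℝ) ≤ 4 / 3 := by linarith
        have : m₂ < 2 := by exact_mod_cast (show (m₂ : ℝ) < 2 by linarith)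
        omega
      subst hm
      rw [hg]
      push_cast
      by_cases h6' : 6 ≤ g₁
      · have h6₁ : (6 : ℝ) ≤ g₁ := by exact_mod_cast h6'
        nlinarith
      · have hg' : g₁ = 5 := by omega
        have hm' : m₁ = 1 := by
          have : (12 * m₁ + 9 : ℝ) ≤ 25 := by rw [hg'] at hsq₁; norm_num at hsq₁; linarith
          have : (m₁ : ℝ) ≤ 4 / 3 := by linarith
          have : m₁ < 2 := by exact_mod_cast (show (m₁ : ℝ) < 2 by linarith)
          omega
        subst hm'
        rw [hg']
        norm_num

/-- **The number of darts is even** (each contact pair carries two). [cite: Harborth1974, p. 14] -/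
theorem even_card_darts (P : Finset ℂ) : Even (darts P).card := by
  classical
  have hmaps : Set.MapsTo (fun d : ℂ × ℂ => s(d.1, d.2)) (darts P : Set (ℂ × ℂ))
      ((darts P).image fun d => s(d.1, d.2) : Finset (Sym2 ℂ)) :=
    fun d hd => Finset.mem_coe.2 (Finset.mem_image_of_mem _ (Finset.mem_coe.1 hd))
  rw [Finset.card_eq_sum_card_fiberwise hmaps]
  have htwo : ∀ z ∈ (darts P).image (fun d => s(d.1, d.2)),
      ((darts P).filter fun d => s(d.1, d.2) = z).card = 2 := by
    intro z hz
    obtain ⟨d, hd, rfl⟩ := Finset.mem_image.1 hz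
    have hne : d ≠ d.swap := by
      intro h
      have := ne_of_mem_darts hd
      rw [Prod.ext_iff] at h
      exact this h.1
    have : (darts P).filter (fun e => s(e.1, e.2) = s(d.1, d.2)) = {d, d.swap} := by
      ext e
      simp only [Finset.mem_filter, Finset.mem_insert, Finset.mem_singleton]
      constructor
      · rintro ⟨-, h⟩
        exact Sym2.mk_eq_mk_iff.1 h
      · rintro (rfl | rfl)
        · exact ⟨hd, rfl⟩
        · exact ⟨swap_mem_darts hd, Sym2.mk_eq_mk_iff.2 (Or.inr rfl)⟩
    rw [this, Finset.card_pair hne]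
  rw [Finset.sum_const_nat htwo]
  exact even_two.mul_left _

/-- **A maximal configuration does not split** (Heitmann–Radin, p. 284: "From the maximal property
of `C` it follows that `C_g` is a connected set and furthermore that this property would persist
in the configuration obtained by removing any one disk from `C`"): two far-apart pieces, or two
pieces sharing one disc, carry strictly fewer than `[3n - √(12n - 3)]` contacts.
[cite: HeitmannRadin1980, §4 (p. 284)] -/
theorem not_splits_of_maximal (hP : IsHard P)
    (hmax : 2 * harborthNumber P.card ≤ ((darts P).card : ℤ)) : ¬ Splits P := by
  classical
  rintro (⟨A, B, hA, hB, hAB, hABP, hno⟩ | ⟨v, A, B, hvA, hvB, hA, hB, hAB, hABP, hno⟩)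
  · -- two far-apart pieces
    have hcard : A.card + B.card = P.card := by rw [← card_union_of_disjoint hAB, hABP]
    have hA1 := hA.card_pos
    have hB1 := hB.card_pos
    have bA := card_darts_le A (hP.mono (hABP ▸ subset_union_left))
    have bB := card_darts_le B (hP.mono (hABP ▸ subset_union_right))
    rw [card_darts_of_split hAB hABP hno] at hmax
    push_cast at hmax
    obtain ⟨m₁, hm₁⟩ : ∃ m, A.card = m + 1 := ⟨A.card - 1, by omega⟩
    obtain ⟨m₂, hm₂⟩ : ∃ m, B.card = m + 1 := ⟨B.card - 1, by omega⟩
    have key := harborthNumber_add_le m₁ m₂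
    have hlt := harborthNumber_lt_succ (n := m₁ + m₂ + 1) (by omega)
    rw [← hm₁, ← hm₂] at key
    rw [show m₁ + m₂ + 1 + 1 = P.card by omega] at hlt
    linarith
  · -- a cut disc `v`
    have hvAB : v ∉ A ∪ B := by simp [hvA, hvB]
    have hcard : A.card + B.card + 1 = P.card := by
      rw [← hABP, card_insert_of_notMem hvAB, card_union_of_disjoint hAB]
    have hA1 := hA.card_pos
    have hB1 := hB.card_pos
    have hcA : (insert v A).card = A.card + 1 := card_insert_of_notMem hvA
    have hcB : (insert v B).card = B.card + 1 := card_insert_of_notMem hvB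
    have hsubA : insert v A ⊆ P := by rw [← hABP]; exact insert_subset_insert v subset_union_left
    have hsubB : insert v B ⊆ P := by rw [← hABP]; exact insert_subset_insert v subset_union_right
    have bA := card_darts_le (insert v A) (hP.mono hsubA)
    have bB := card_darts_le (insert v B) (hP.mono hsubB)
    rw [hcA] at bA
    rw [hcB] at bB
    rw [card_darts_of_split_vertex hAB hABP hno] at hmax
    push_cast at hmax
    have key := harborthNumber_add_lt (m₁ := A.card) (m₂ := B.card) (by omega) (by omega)
    rw [hcard] at key
    linarith

/-- The neighbours of a centre in a sub-configuration are among its neighbours. [folklore] -/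
private theorem nbrs_mono {Q : Finset ℂ} (hQ : Q ⊆ P) (p : ℂ) : nbrs Q p ⊆ nbrs P p := fun _ hk =>
  mem_nbrs.2 ⟨hQ (mem_nbrs.1 hk).1, (mem_nbrs.1 hk).2⟩

/-- Two distinct neighbours make the degree at least two (local copy). [folklore] -/
private theorem two_le_card_nbrs_of_ne' {p k k' : ℂ} (hk : k ∈ nbrs P p) (hk' : k' ∈ nbrs P p)
    (hne : k ≠ k') : 2 ≤ (nbrs P p).card := by
  have hsub : ({k, k'} : Finset ℂ) ⊆ nbrs P p := by
    intro x hx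
    rcases Finset.mem_insert.1 hx with rfl | hx
    · exact hk
    · rw [Finset.mem_singleton.1 hx]; exact hk'
  have := Finset.card_le_card hsub
  rwa [Finset.card_pair hne] at this

/-! ## §2 "A strict inequality from (6)" -/

section Boundary

variable {hne : P.Nonempty} {h2 : ∀ p ∈ P, 2 ≤ (nbrs P p).card}

/-- The outer corner at `bdry i` is the dart `traceDart (i + a - 1) = (bdry (i-1), bdry i)`.
[cite: Harborth1974, p. 14] -/
theorem traceDart_add_period_sub_one (i : ℕ) :
    traceDart P hne h2 (i + period P hne h2 - 1) =
      (bdry P hne h2 ((i : ℤ) - 1), bdry P hne h2 i) := by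
  have hT := period_pos (hne := hne) (h2 := h2)
  rw [traceDart_eq_bdry]
  have e1 : bdry P hne h2 ((i + period P hne h2 - 1 : ℕ) : ℤ) = bdry P hne h2 ((i : ℤ) - 1) := by
    rw [← bdry_periodic ((i : ℤ) - 1), Nat.cast_sub (by omega), Nat.cast_add, Nat.cast_one]
    ring_nf
  have e2 : bdry P hne h2 (((i + period P hne h2 - 1 : ℕ) : ℤ) + 1) = bdry P hne h2 i := by
    rw [← bdry_periodic (i : ℤ), Nat.cast_sub (by omega), Nat.cast_add, Nat.cast_one]
    ring_nf
  rw [e1, e2]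

/-- Indices congruent modulo the period give the same boundary centre. [cite: Harborth1974, p. 14] -/
theorem bdry_eq_of_emod_eq {i j : ℤ} (h : i % (period P hne h2 : ℤ) = j % (period P hne h2 : ℤ)) :
    bdry P hne h2 i = bdry P hne h2 j := by
  unfold bdry
  rw [h]

/-- **Heitmann–Radin's "strict inequality from (6)"**: if at some boundary vertex a corner OTHER
than the outer one is not tight (angle `≠ π/3`), then `∑_{v ∈ boundary} deg v ≤ 4a - 7`.
[cite: HeitmannRadin1980, p. 286] -/
theorem sum_card_nbrs_bdrySet_le_of_ne (hP : IsHard P) (hns : ¬ Splits P)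
    (hw : ∃ i, i < period P hne h2 ∧ ∃ k ∈ nbrs P (bdry P hne h2 i),
      k ≠ bdry P hne h2 ((i : ℤ) - 1) ∧ gapAngle P k (bdry P hne h2 i) ≠ π / 3) :
    (∑ v ∈ bdrySet P hne h2, ((nbrs P v).card : ℤ)) + 7 ≤ 4 * (bdrySet P hne h2).card := by
  have hπ := Real.pi_pos
  set T := period P hne h2 with hT
  have hsum := sum_extAngle_bdry (hne := hne) (h2 := h2) hP hns
  have hloc : ∀ m ∈ Finset.range T,
      (((nbrs P (bdry P hne h2 m)).card : ℝ) - 1) * (π / 3) ≤ π - extAngle (bdry P hne h2) m := by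
    intro m _
    have h := gapAngle_add_le hP (bdry_pred_mem_nbrs (hne := hne) (h2 := h2) (m : ℤ))
      (h2 _ (bdry_mem _))
    rw [gapAngle_bdry hP hns] at h
    linarith
  obtain ⟨i, hi, k, hk, hki, hwk⟩ := hw
  have hstrict : (((nbrs P (bdry P hne h2 i)).card : ℝ) - 1) * (π / 3) <
      π - extAngle (bdry P hne h2) i := by
    have h := gapAngle_add_lt hP (bdry_pred_mem_nbrs (hne := hne) (h2 := h2) (i : ℤ))
      (h2 _ (bdry_mem _)) ⟨k, hk, hki, hwk⟩
    rw [gapAngle_bdry hP hns] at h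
    linarith
  have hlt := Finset.sum_lt_sum hloc ⟨i, Finset.mem_range.2 hi, hstrict⟩
  rw [← Finset.sum_mul, Finset.sum_sub_distrib, Finset.sum_sub_distrib, hsum] at hlt
  simp only [Finset.sum_const, Finset.card_range, nsmul_eq_mul, mul_one] at hlt
  have hreal : (∑ m ∈ Finset.range T, ((nbrs P (bdry P hne h2 m)).card : ℝ)) < 4 * T - 6 := by
    nlinarith
  -- transfer to the boundary set
  have hinj : Set.InjOn (fun m : ℕ => bdry P hne h2 m) (Finset.range T : Set ℕ) :=
    fun a ha b hb h => bdry_injOn hP hns (Finset.mem_range.1 (Finset.mem_coe.1 ha))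
      (Finset.mem_range.1 (Finset.mem_coe.1 hb)) h
  rw [card_bdrySet hP hns, bdrySet, Finset.sum_image hinj]
  have e : ((∑ m ∈ Finset.range T, ((nbrs P (bdry P hne h2 m)).card : ℤ) : ℤ) : ℝ) =
      ∑ m ∈ Finset.range T, ((nbrs P (bdry P hne h2 m)).card : ℝ) := by
    push_cast; rfl
  have h' : ((∑ m ∈ Finset.range T, ((nbrs P (bdry P hne h2 m)).card : ℤ) : ℤ) : ℝ) <
      ((4 * T - 6 : ℤ) : ℝ) := by
    rw [e]; push_cast; exact hreal
  have := (Int.cast_lt (R := ℝ)).1 h'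
  rw [← hT]
  omega

end Boundary

/-! ## §3 The induction: every corner of a maximal configuration is tight or outer -/

/-- **Heitmann–Radin's (4̃′), (7′), (8′) — the arithmetic.** For a configuration with `D` darts,
boundary of `a` centres (`3 ≤ a ≤ n`) carrying `DS` darts and degree sum `σS`, interior degree
sum `σI`, interior darts `D'`, Harborth's relations `D = σS + σI`, `D + DS = D' + 2σS`,
`DS ≥ 2a`, `σS ≤ 4a - 6`, `σI ≤ 6(n - a)`, `D' ≤ 2[f(n-a)]`, and MAXIMALITY `2[f(n)] ≤ D`: if one
of the two degree bounds is strict — (4̃′) — then the boundary carries exactly `3a - 6` bonds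
((7′) fails), the interior configuration is maximal (the minimality clause fails), and
`σS = 4a - 6`; for otherwise the peel step (8′) bounds `E + 1` by `[f(n)]`.
[cite: HeitmannRadin1980, p. 286] -/
theorem hr_equality_case {n a : ℕ} {D D' DS σS σI : ℤ} (ha3 : 3 ≤ a) (han : a ≤ n)
    (hmax : 2 * harborthNumber n ≤ D) (hD' : D' ≤ 2 * harborthNumber (n - a))
    (hevD : Even D) (hevD' : Even D')
    (hsplit : D = σS + σI) (hbook : D + DS = D' + 2 * σS) (hDS : 2 * (a : ℤ) ≤ DS)
    (hS : σS + 6 ≤ 4 * a) (hI : σI ≤ 6 * ((n : ℤ) - a))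
    (hstrict : σS + 7 ≤ 4 * a ∨ σI + 1 ≤ 6 * ((n : ℤ) - a)) :
    D = D' + 6 * a - 12 ∧ 2 * harborthNumber (n - a) ≤ D' ∧ σS + 6 = 4 * a := by
  obtain ⟨E, hE⟩ := hevD
  obtain ⟨E', hE'⟩ := hevD'
  have han' : (a : ℤ) ≤ n := by exact_mod_cast han
  have h1 : E + 1 ≤ 3 * (n : ℤ) - a - 3 := by rcases hstrict with h | h <;> omega
  have hpeel : ∀ E'' : ℤ, E + 1 ≤ E'' + 3 * a - 6 → E'' ≤ harborthNumber (n - a) → False := by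
    intro E'' hB hC
    have := le_harborthNumber_of_peel ha3 han h1 hB hC
    omega
  have hDeq : D = D' + 6 * a - 12 := by
    by_contra hne
    exact hpeel E' (by omega) (by omega)
  refine ⟨hDeq, ?_, by omega⟩
  by_contra hlt
  exact hpeel (E' + 1) (by omega) (by omega)

section Induction

variable {hne : P.Nonempty} {h2 : ∀ p ∈ P, 2 ≤ (nbrs P p).card}

/-- **Harborth's bookkeeping for the boundary set of a non-splitting configuration**, collected:
`3 ≤ a ≤ n`, `D = σS + σI`, `D + DS = D' + 2σS`, `DS ≥ 2a`, `σS ≤ 4a - 6`, `σI ≤ 6(n - a)`,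
`D' ≤ 2[f(n-a)]`, `#(P ∖ S) = n - a`. [cite: Harborth1974, (1)–(4)] -/
theorem boundary_bookkeeping (hP : IsHard P) (hns : ¬ Splits P) :
    3 ≤ (bdrySet P hne h2).card ∧ (bdrySet P hne h2).card ≤ P.card ∧
    ((darts P).card : ℤ) = (∑ v ∈ bdrySet P hne h2, ((nbrs P v).card : ℤ)) +
        ((∑ v ∈ P \ bdrySet P hne h2, (nbrs P v).card : ℕ) : ℤ) ∧
    ((darts P).card : ℤ) + (darts (bdrySet P hne h2)).card =
        (darts (P \ bdrySet P hne h2)).card + 2 * ∑ v ∈ bdrySet P hne h2, ((nbrs P v).card : ℤ) ∧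
    2 * ((bdrySet P hne h2).card : ℤ) ≤ (darts (bdrySet P hne h2)).card ∧
    (∑ v ∈ bdrySet P hne h2, ((nbrs P v).card : ℤ)) + 6 ≤ 4 * (bdrySet P hne h2).card ∧
    ((∑ v ∈ P \ bdrySet P hne h2, (nbrs P v).card : ℕ) : ℤ) ≤
        6 * ((P.card : ℤ) - (bdrySet P hne h2).card) ∧
    ((darts (P \ bdrySet P hne h2)).card : ℤ) ≤ 2 * harborthNumber (P.card - (bdrySet P hne h2).card) ∧
    (P \ bdrySet P hne h2).card = P.card - (bdrySet P hne h2).card := by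
  classical
  set S := bdrySet P hne h2 with hS
  have hSP : S ⊆ P := bdrySet_subset
  have hScard : S.card = period P hne h2 := card_bdrySet hP hns
  have hT3 : 3 ≤ S.card := by rw [hScard]; exact three_le_period
  have haP : S.card ≤ P.card := Finset.card_le_card hSP
  have hP'card : (P \ S).card = P.card - S.card := Finset.card_sdiff_of_subset hSP
  refine ⟨hT3, haP, ?_, ?_, ?_, sum_card_nbrs_bdrySet_le hP hns, ?_, ?_, hP'card⟩
  · rw [card_darts_eq_sum, ← Finset.sum_sdiff hSP]; push_cast; ring
  · exact_mod_cast card_darts_add_card_darts_eq hSP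
  · exact_mod_cast two_mul_card_le_card_darts_bdrySet hP hns
  · have := Finset.sum_le_card_nsmul (P \ S) (fun v => (nbrs P v).card) 6
      (fun v hv => card_nbrs_le_six hP v)
    rw [hP'card, smul_eq_mul] at this
    have h' : ((∑ v ∈ P \ S, (nbrs P v).card : ℕ) : ℤ) ≤ (((P.card - S.card) * 6 : ℕ) : ℤ) := by
      exact_mod_cast this
    rw [Nat.cast_mul, Nat.cast_sub haP] at h'
    simp only [Nat.cast_ofNat] at h'
    linarith
  · rw [← hP'card]; exact card_darts_le _ (hP.mono Finset.sdiff_subset)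

/-- **STEP 1 — "the nontriangle touches `∂C_g`".** In a maximal non-splitting configuration every
corner at a boundary vertex other than the outer one is tight: otherwise `∑_∂ deg ≤ 4a - 7`
contradicts the equality case forced by `hr_equality_case`. [cite: HeitmannRadin1980, p. 286] -/
theorem boundary_corner_tight (hP : IsHard P) (hns : ¬ Splits P)
    (hmax : 2 * harborthNumber P.card ≤ ((darts P).card : ℤ)) {i : ℕ} (hi : i < period P hne h2)
    {k : ℂ} (hk : k ∈ nbrs P (bdry P hne h2 i)) (hki : k ≠ bdry P hne h2 ((i : ℤ) - 1)) :
    gapAngle P k (bdry P hne h2 i) = π / 3 := by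
  classical
  by_contra hw
  have h7 := sum_card_nbrs_bdrySet_le_of_ne hP hns ⟨i, hi, k, hk, hki, hw⟩
  obtain ⟨hT3, haP, hsplit, hbook, hDS, hS, hI, hD', -⟩ :=
    boundary_bookkeeping (hne := hne) (h2 := h2) hP hns
  obtain ⟨-, -, hEq⟩ := hr_equality_case hT3 haP hmax hD'
    (by exact_mod_cast even_card_darts P) (by exact_mod_cast even_card_darts (P \ bdrySet P hne h2))
    hsplit hbook hDS hS hI (Or.inl h7)
  omega

/-- **The face walk of a wide interior corner avoids the boundary.** If every non-outer boundary
corner is tight and `c₀` is a non-tight corner at an interior vertex, then every dart along the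
face walk of `c₀` has both ends off the boundary (a wide corner with its head on the boundary
would be outer, making the whole walk the boundary walk) and is non-tight.
[cite: HeitmannRadin1980, p. 286] -/
theorem walk_avoids_boundary (hP : IsHard P)
    (hbt : ∀ i, i < period P hne h2 → ∀ k ∈ nbrs P (bdry P hne h2 i),
      k ≠ bdry P hne h2 ((i : ℤ) - 1) → gapAngle P k (bdry P hne h2 i) = π / 3)
    {c₀ : ℂ × ℂ} (hc₀ : c₀ ∈ darts P) (hv₀ : c₀.2 ∉ bdrySet P hne h2)
    (hw₀ : gapAngle P c₀.1 c₀.2 ≠ π / 3) (j : ℕ) :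
    (next P)^[j] c₀ ∈ darts (P \ bdrySet P hne h2) ∧
      gapAngle P ((next P)^[j] c₀).1 ((next P)^[j] c₀).2 ≠ π / 3 := by
  classical
  set T := period P hne h2 with hT
  obtain ⟨Tc, hTc, hper⟩ := exists_isPeriodicPt_next h2 hc₀
  have hwide : ∀ j, gapAngle P ((next P)^[j] c₀).1 ((next P)^[j] c₀).2 ≠ π / 3 :=
    gapAngle_iterate_ne_of_ne hP h2 hc₀ hw₀
  have hdart : ∀ j, (next P)^[j] c₀ ∈ darts P := iterate_next_mem_darts hc₀
  -- heads avoid the boundary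
  have hhead : ∀ j, ((next P)^[j] c₀).2 ∉ bdrySet P hne h2 := by
    intro j hjS
    obtain ⟨i, hi, hiv⟩ := Finset.mem_image.1 hjS
    have hi' : i < T := Finset.mem_range.1 hi
    obtain ⟨q, v, hdj⟩ : ∃ q v : ℂ, (next P)^[j] c₀ = (q, v) := ⟨_, _, rfl⟩
    rw [hdj] at hiv
    simp only at hiv
    have hqv : (q, v) ∈ darts P := hdj ▸ hdart j
    have hk : q ∈ nbrs P (bdry P hne h2 i) := by rw [hiv]; exact mem_nbrs_of_mk_mem_darts' hqv
    -- the corner is wide, hence outer: its tail is the previous boundary centre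
    have hki : q = bdry P hne h2 ((i : ℤ) - 1) := by
      by_contra hki
      have := hbt i hi' q hk hki
      rw [hiv] at this
      have hw := hwide j
      rw [hdj] at hw
      exact hw this
    have hdt : (next P)^[j] c₀ = traceDart P hne h2 (i + T - 1) := by
      rw [traceDart_add_period_sub_one, hdj, hki, hiv]
    -- so `c₀` itself is a trace dart, and its head is on the boundary
    have hj_le : j ≤ Tc * (j + 1) := by
      have := Nat.le_mul_of_pos_left (j + 1) hTc
      omega
    have hback : c₀ = (next P)^[Tc * (j + 1) - j] ((next P)^[j] c₀) := by
      rw [← Function.iterate_add_apply, Nat.sub_add_cancel hj_le]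
      exact ((hper.mul_const (j + 1)).eq).symm
    have hc₀t : c₀ = traceDart P hne h2 (Tc * (j + 1) - j + (i + T - 1)) := by
      rw [hback, hdt, traceDart, traceDart, ← Function.iterate_add_apply]
    apply hv₀
    rw [hc₀t, traceDart_eq_bdry]
    exact bdry_mem_bdrySet _
  -- tails avoid the boundary
  have htail : ∀ j, ((next P)^[j] c₀).1 ∉ bdrySet P hne h2 := by
    intro j
    have e : (next P)^[j] c₀ = next P ((next P)^[j + (Tc - 1)] c₀) := by
      rw [← Function.iterate_succ_apply' (f := next P), Nat.succ_eq_add_one,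
        show j + (Tc - 1) + 1 = j + Tc by omega, Function.iterate_add_apply, hper.eq]
    rw [e]
    exact hhead _
  refine ⟨?_, hwide j⟩
  rw [darts_subset_eq_filter Finset.sdiff_subset]
  exact Finset.mem_filter.2 ⟨hdart j,
    Finset.mem_sdiff.2 ⟨(mem_darts.1 (hdart j)).1.1, htail j⟩,
    Finset.mem_sdiff.2 ⟨(mem_darts.1 (hdart j)).1.2, hhead j⟩⟩

end Induction

/-- **Corners of a sub-configuration along a surviving walk.** If a dart `d` and its successor
dart `next P d` both survive in `Q ⊆ P`, the corner of `d` has the same angle and the same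
successor in `Q` as in `P` (and its head keeps two neighbours). [cite: HeitmannRadin1980, p. 286] -/
theorem gapAngle_sub_eq {Q : Finset ℂ} (hQ : Q ⊆ P) (h2 : ∀ p ∈ P, 2 ≤ (nbrs P p).card)
    {d : ℂ × ℂ} (hd : d ∈ darts Q) (hr : next P d ∈ darts Q) :
    gapAngle Q d.1 d.2 = gapAngle P d.1 d.2 ∧ succ Q d.1 d.2 = succ P d.1 d.2 ∧
      2 ≤ (nbrs Q d.2).card := by
  obtain ⟨q, v⟩ := d
  simp only
  have hq' : q ∈ nbrs Q v := mem_nbrs_of_mk_mem_darts' hd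
  have hvP : v ∈ P := hQ (mem_darts.1 hd).1.2
  have hr' : succ P q v ∈ nbrs Q v := mem_nbrs_of_mk_mem_darts hr
  have hrq : succ P q v ≠ q := succ_ne (h2 _ hvP)
  have h2d : 2 ≤ (nbrs Q v).card := two_le_card_nbrs_of_ne' hr' hq' hrq
  have hle1 : gapAngle Q q v ≤ gapAngle P q v := gapAngle_le_ccwAngle (P := Q) hr' hrq
  have hle2 : gapAngle P q v ≤ gapAngle Q q v :=
    gapAngle_le_ccwAngle (P := P) (nbrs_mono hQ _ (succ_mem_nbrs hq')) (succ_ne h2d)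
  have heq : gapAngle Q q v = gapAngle P q v := le_antisymm hle1 hle2
  exact ⟨heq, (eq_succ_of_ccwAngle_eq (P := Q) hq' hr' (by rw [heq]; rfl)).symm, h2d⟩

/-- **A surviving walk is a walk of the sub-configuration.** [cite: HeitmannRadin1980, p. 286] -/
theorem iterate_next_sub_eq {Q : Finset ℂ} (hQ : Q ⊆ P) (h2 : ∀ p ∈ P, 2 ≤ (nbrs P p).card)
    {c₀ : ℂ × ℂ} (hw : ∀ j, (next P)^[j] c₀ ∈ darts Q) (j : ℕ) :
    (next Q)^[j] c₀ = (next P)^[j] c₀ := by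
  induction j with
  | zero => rfl
  | succ j ih =>
    have hr : next P ((next P)^[j] c₀) ∈ darts Q := by
      have := hw (j + 1)
      rwa [Function.iterate_succ_apply'] at this
    obtain ⟨-, hs, -⟩ := gapAngle_sub_eq hQ h2 (hw j) hr
    rw [Function.iterate_succ_apply', Function.iterate_succ_apply', ih]
    change ((((next P)^[j] c₀).2, succ Q ((next P)^[j] c₀).1 ((next P)^[j] c₀).2) : ℂ × ℂ) =
      (((next P)^[j] c₀).2, succ P ((next P)^[j] c₀).1 ((next P)^[j] c₀).2)
    rw [hs]

/-- **No bond can reach the outer boundary of a sub-configuration whose outer corners are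
corners of the ambient one.** Let `Q ⊆ P` have every corner tight or outer, and let its outer
boundary walk be a face walk of `P` (same corners, same angles). Then no centre of `Q` touches a
centre of `P` outside `Q`: the bond direction would lie strictly inside a corner of `Q` at that
centre — inside a tight corner two bonds would make an angle `< π/3`, inside an outer corner of
`Q` the corner of `P` would be smaller. [cite: HeitmannRadin1980, p. 286] -/
theorem false_of_outer_walk (hP : IsHard P) {Q : Finset ℂ} (hQ : Q ⊆ P)
    (h2 : ∀ p ∈ P, 2 ≤ (nbrs P p).card) {hneQ : Q.Nonempty} {h2Q : ∀ p ∈ Q, 2 ≤ (nbrs Q p).card}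
    (htQ : ∀ d ∈ darts Q, gapAngle Q d.1 d.2 = π / 3 ∨ d ∈ Set.range (traceDart Q hneQ h2Q))
    {c₀ : ℂ × ℂ} (hwalk : ∀ j, (next P)^[j] c₀ ∈ darts Q)
    (houter : ∀ m, ∃ j, traceDart Q hneQ h2Q m = (next P)^[j] c₀)
    {s v : ℂ} (hsP : s ∈ P) (hsQ : s ∉ Q) (hv : v ∈ Q) (hsv : ‖v - s‖ = 1) : False := by
  have hπ := Real.pi_pos
  have hs_nb : s ∈ nbrs P v := mem_nbrs.2 ⟨hsP, by rw [norm_sub_rev]; exact hsv⟩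
  have hdir : ∀ k ∈ nbrs Q v, ccwAngle (k - v) (s - v) ≠ 0 := by
    intro k hk h0
    have := eq_of_ccwAngle_eq_zero (nbrs_mono hQ _ hk) hs_nb h0
    exact hsQ (this ▸ (mem_nbrs.1 hk).1)
  obtain ⟨q, hq', hpos, hqlt⟩ := exists_corner_containing (h2Q v hv) hdir
  have hqP : q ∈ nbrs P v := nbrs_mono hQ _ hq'
  have hqs : q ≠ s := fun h => hsQ (h ▸ (mem_nbrs.1 hq').1)
  have hqv : (q, v) ∈ darts Q :=
    mem_darts.2 ⟨⟨(mem_nbrs.1 hq').1, hv⟩, by rw [norm_sub_rev]; exact (mem_nbrs.1 hq').2⟩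
  rcases htQ (q, v) hqv with htq | ⟨m, hm⟩
  · -- a tight corner of `Q` cannot contain a further bond
    have := (ccwAngle_nbrs hP hqP hs_nb hqs).1
    simp only at htq
    linarith
  · -- an outer corner of `Q` is a corner of the walk, whose angle is the same in `P`
    obtain ⟨j, hj⟩ := houter m
    rw [hm] at hj
    have hr : next P ((next P)^[j] c₀) ∈ darts Q := by
      have := hwalk (j + 1)
      rwa [Function.iterate_succ_apply'] at this
    have hag := (gapAngle_sub_eq hQ h2 (hwalk j) hr).1
    rw [← hj] at hag
    simp only at hag
    have := gapAngle_le_ccwAngle (P := P) hs_nb (Ne.symm hqs)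
    linarith

/-- Splitting off a centre with at most five neighbours from a degree sum bounded by six each.
[cite: HeitmannRadin1980, p. 286] -/
private theorem sum_card_nbrs_succ_le (hP : IsHard P) {R : Finset ℂ} {v : ℂ} (hv : v ∈ R)
    (h5 : (nbrs P v).card ≤ 5) : ∑ w ∈ R, (nbrs P w).card + 1 ≤ 6 * R.card := by
  classical
  rw [← Finset.add_sum_erase _ _ hv]
  have hrest := Finset.sum_le_card_nsmul (R.erase v) (fun w => (nbrs P w).card) 6
    (fun w _ => card_nbrs_le_six hP w)
  rw [Finset.card_erase_of_mem hv, smul_eq_mul] at hrest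
  have hpos : 1 ≤ R.card := Finset.card_pos.2 ⟨v, hv⟩
  have : (R.card - 1) * 6 + 6 = 6 * R.card := by omega
  have hrest' : (R.erase v).sum (fun w => (nbrs P w).card) ≤ (R.card - 1) * 6 := hrest
  linarith

/-- **Heitmann–Radin 1980, Theorem (2)(a), local form.** In a maximal configuration of `n ≥ 3`
unit discs (at least — hence exactly — `[3n - √(12n-3)]` contact pairs), every corner is either
tight (angle `π/3`: the two bonds span a unit triangle) or one of the `a` outer corners of the
boundary polygon. Proof by strong induction on `n` along Heitmann–Radin's minimal-counterexample
argument (module docstring). [cite: HeitmannRadin1980, Theorem (2)(a)] -/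
theorem tight_or_outer_of_maximal :
    ∀ (n : ℕ) (P : Finset ℂ), IsHard P → P.card = n → 3 ≤ n →
      2 * harborthNumber n ≤ ((darts P).card : ℤ) →
      ∀ (hne : P.Nonempty) (h2 : ∀ p ∈ P, 2 ≤ (nbrs P p).card),
        ∀ d ∈ darts P, gapAngle P d.1 d.2 = π / 3 ∨ d ∈ Set.range (traceDart P hne h2) := by
  intro n
  induction n using Nat.strong_induction_on with
  | _ n ih =>
  intro P hP hn h3 hmax hne h2
  classical
  subst hn
  have hns : ¬ Splits P := not_splits_of_maximal hP hmax
  set S := bdrySet P hne h2 with hS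
  have hSP : S ⊆ P := bdrySet_subset
  have hScard : S.card = period P hne h2 := card_bdrySet hP hns
  -- STEP 1
  have hbt : ∀ i, i < period P hne h2 → ∀ k ∈ nbrs P (bdry P hne h2 i),
      k ≠ bdry P hne h2 ((i : ℤ) - 1) → gapAngle P k (bdry P hne h2 i) = π / 3 :=
    fun i hi k hk hki => boundary_corner_tight hP hns hmax hi hk hki
  -- STEP 2: every corner at an interior vertex is tight
  have hint : ∀ d ∈ darts P, d.2 ∉ S → gapAngle P d.1 d.2 = π / 3 := by
    intro c₀ hc₀ hv₀
    by_contra hw₀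
    obtain ⟨q₀, v₀⟩ := c₀
    simp only at hv₀ hw₀
    have hq₀ : q₀ ∈ nbrs P v₀ := mem_nbrs_of_mk_mem_darts' hc₀
    have hv₀P : v₀ ∈ P := (mem_darts.1 hc₀).1.2
    have hv₀' : v₀ ∈ P \ S := Finset.mem_sdiff.2 ⟨hv₀P, hv₀⟩
    -- (4̃′) at `v₀`, and the equality case
    have hdeg5 : (nbrs P v₀).card ≤ 5 := card_nbrs_le_five_of_ne hP hq₀ hw₀
    obtain ⟨hT3, haP, hsplit, hbook, hDS, hSdeg, hI, hD', hP'card⟩ :=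
      boundary_bookkeeping (hne := hne) (h2 := h2) hP hns
    rw [← hS] at hT3 haP hsplit hbook hDS hSdeg hI hD' hP'card
    have hI' : ((∑ v ∈ P \ S, (nbrs P v).card : ℕ) : ℤ) + 1 ≤ 6 * ((P.card : ℤ) - S.card) := by
      have h6 := sum_card_nbrs_succ_le hP hv₀' hdeg5
      rw [hP'card] at h6
      have h' : ((∑ v ∈ P \ S, (nbrs P v).card : ℕ) : ℤ) + 1 ≤ 6 * ((P.card - S.card : ℕ) : ℤ) := by
        exact_mod_cast h6
      rwa [Nat.cast_sub haP] at h'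
    obtain ⟨hDeq, hmax', -⟩ := hr_equality_case hT3 haP hmax hD'
      (by exact_mod_cast even_card_darts P) (by exact_mod_cast even_card_darts (P \ S))
      hsplit hbook hDS hSdeg hI (Or.inr hI')
    -- the walk of the wide corner survives in `P' = P \ S`
    have hwalk : ∀ j, (next P)^[j] (q₀, v₀) ∈ darts (P \ S) := fun j =>
      (walk_avoids_boundary hP hbt hc₀ hv₀ hw₀ j).1
    have hiter : ∀ j, (next (P \ S))^[j] (q₀, v₀) = (next P)^[j] (q₀, v₀) :=
      iterate_next_sub_eq Finset.sdiff_subset h2 hwalk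
    have hP'hard : IsHard (P \ S) := hP.mono Finset.sdiff_subset
    -- `P'` has at least three discs and is maximal: the induction hypothesis applies
    have h2v : 2 ≤ (nbrs (P \ S) v₀).card := by
      have hr : next P ((next P)^[0] (q₀, v₀)) ∈ darts (P \ S) := hwalk 1
      exact (gapAngle_sub_eq Finset.sdiff_subset h2 (hwalk 0) hr).2.2
    have h3' : 3 ≤ (P \ S).card := by
      have hsub : nbrs (P \ S) v₀ ⊆ (P \ S).erase v₀ := fun k hk =>
        Finset.mem_erase.2 ⟨ne_of_mem_nbrs hk, (mem_nbrs.1 hk).1⟩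
      have := Finset.card_le_card hsub
      rw [Finset.card_erase_of_mem hv₀'] at this
      omega
    have hlt' : (P \ S).card < P.card := by rw [hP'card]; omega
    have hne' : (P \ S).Nonempty := ⟨_, hv₀'⟩
    rw [← hP'card] at hmax'
    have hns' : ¬ Splits (P \ S) := not_splits_of_maximal hP'hard hmax'
    have h2P' : ∀ p ∈ P \ S, 2 ≤ (nbrs (P \ S) p).card := fun p hp =>
      two_le_card_nbrs_of_not_splits h3' hns' hp
    have IH := ih (P \ S).card hlt' (P \ S) hP'hard rfl h3' hmax' hne' h2P'
    -- the wide corner is an outer corner of `P'`, so `P'`'s boundary walk is its walk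
    obtain ⟨i₀, hi₀⟩ : (q₀, v₀) ∈ Set.range (traceDart (P \ S) hne' h2P') := by
      rcases IH (q₀, v₀) (hwalk 0) with h | h
      · have hag := (gapAngle_sub_eq Finset.sdiff_subset h2 (hwalk 0) (hwalk 1)).1
        simp only [Function.iterate_zero, id_eq] at hag h
        exact absurd (hag.symm.trans h) hw₀
      · exact h
    have houter' : ∀ m, ∃ j, traceDart (P \ S) hne' h2P' m = (next P)^[j] (q₀, v₀) := by
      intro m
      have hT'pos : 0 < period (P \ S) hne' h2P' := period_pos
      have hi₀_le : i₀ ≤ m + period (P \ S) hne' h2P' * (i₀ + 1) := by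
        have := Nat.le_mul_of_pos_left (i₀ + 1) hT'pos
        omega
      refine ⟨m + period (P \ S) hne' h2P' * (i₀ + 1) - i₀, ?_⟩
      rw [← hiter, ← hi₀, traceDart, traceDart, ← Function.iterate_add_apply,
        Nat.sub_add_cancel hi₀_le]
      exact traceDart_eq_of_mod_eq (by rw [Nat.add_mul_mod_self_left])
    -- a bond between the boundary and `P'` exists (no split) — contradiction
    obtain ⟨s, hs, v, hv, hsv⟩ : ∃ s ∈ S, ∃ v ∈ P \ S, ‖v - s‖ = 1 := by
      by_contra hno
      push Not at hno
      apply hns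
      refine Or.inl ⟨S, P \ S, ?_, hne', Finset.disjoint_sdiff, Finset.union_sdiff_of_subset hSP,
        fun a ha b hb => hno a ha b hb⟩
      rw [← Finset.card_pos]; omega
    exact false_of_outer_walk hP Finset.sdiff_subset h2 IH hwalk houter' (hSP hs)
      (fun h => (Finset.mem_sdiff.1 h).2 hs) hv hsv
  -- conclusion
  intro d hd
  by_cases hdS : d.2 ∈ S
  · obtain ⟨i, hi, hiv⟩ := Finset.mem_image.1 hdS
    have hi' : i < period P hne h2 := Finset.mem_range.1 hi
    obtain ⟨k, p⟩ := d
    simp only at hiv ⊢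
    have hk : k ∈ nbrs P (bdry P hne h2 i) := by rw [hiv]; exact mem_nbrs_of_mk_mem_darts' hd
    by_cases hki : k = bdry P hne h2 ((i : ℤ) - 1)
    · right
      refine ⟨i + period P hne h2 - 1, ?_⟩
      rw [traceDart_add_period_sub_one, hki, hiv]
    · left
      have := hbt i hi' k hk hki
      rwa [hiv] at this
  · left
    exact hint d hd hdS

/-! ## §4 Tight or outer everywhere ⇒ one triangular lattice -/

/-- **From local tightness to the lattice.** If a hard non-splitting configuration has every
corner tight or outer, then all its centres lie on one congruent copy `t + u (ℤ + ℤζ)`,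
`|u| = 1`, `ζ = e^{iπ/3}`, of the triangular lattice: at each centre all bond directions are
`u_p ζ^j` (coherence, `UnitDiscFanCycle`), a bond forces `u_q ∈ u_p ζ^ℤ`, and the configuration is
connected. [cite: HeitmannRadin1980, Theorem (2)(a)] -/
theorem exists_lattice_of_tight (hP : IsHard P) (hns : ¬ Splits P) {hne : P.Nonempty}
    {h2 : ∀ p ∈ P, 2 ≤ (nbrs P p).card}
    (ht : ∀ d ∈ darts P, gapAngle P d.1 d.2 = π / 3 ∨ d ∈ Set.range (traceDart P hne h2)) :
    ∃ u t : ℂ, ‖u‖ = 1 ∧ ∀ p ∈ P, ∃ a b : ℤ,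
      p = t + u * ((a : ℂ) + (b : ℂ) * Complex.exp (((π / 3 : ℝ) : ℂ) * I)) := by
  classical
  set ζ := Complex.exp (((π / 3 : ℝ) : ℂ) * I) with hζ
  have hz3 : ζ ^ 3 = -1 := exp_pi_div_three_mul_I_pow_three
  have hz6 : ζ ^ 6 = 1 := exp_pi_div_three_mul_I_pow_six
  -- coherence at every centre
  have hcoh : ∀ p ∈ P, ∃ u : ℂ, ‖u‖ = 1 ∧ ∀ k ∈ nbrs P p, ∃ j : ℕ, k - p = u * ζ ^ j := by
    intro p hp
    obtain ⟨qs, hqs, hts⟩ : ∃ qs ∈ nbrs P p, ∀ k ∈ nbrs P p, k ≠ qs → gapAngle P k p = π / 3 := by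
      by_cases hpS : p ∈ bdrySet P hne h2
      · obtain ⟨i, -, hip⟩ := Finset.mem_image.1 hpS
        refine ⟨bdry P hne h2 ((i : ℤ) - 1), hip ▸ bdry_pred_mem_nbrs (i : ℤ), fun k hk hki => ?_⟩
        rcases ht (k, p) (mem_darts.2 ⟨⟨(mem_nbrs.1 hk).1, hp⟩,
          by rw [norm_sub_rev]; exact (mem_nbrs.1 hk).2⟩) with h | ⟨m, hm⟩
        · exact h
        · exfalso
          rw [traceDart_eq_bdry] at hm
          obtain ⟨hm1, hm2⟩ := Prod.mk.inj hm
          have hp' : bdry P hne h2 ((m : ℤ) + 1) = bdry P hne h2 i := hm2.trans hip.symm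
          have hmod := emod_eq_of_bdry_eq hP hns hp'
          have hkm : bdry P hne h2 (m : ℤ) = bdry P hne h2 ((i : ℤ) - 1) := by
            apply bdry_eq_of_emod_eq
            have e : (m : ℤ) = ((m : ℤ) + 1) - 1 := by ring
            rw [e, Int.sub_emod, hmod, ← Int.sub_emod]
          exact hki (hm1.symm.trans hkm)
      · obtain ⟨qs, hqs⟩ : (nbrs P p).Nonempty := Finset.card_pos.1 (by have := h2 p hp; omega)
        refine ⟨qs, hqs, fun k hk _ => ?_⟩
        rcases ht (k, p) (mem_darts.2 ⟨⟨(mem_nbrs.1 hk).1, hp⟩,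
          by rw [norm_sub_rev]; exact (mem_nbrs.1 hk).2⟩) with h | ⟨m, hm⟩
        · exact h
        · exfalso
          apply hpS
          rw [traceDart_eq_bdry] at hm
          rw [← (Prod.mk.inj hm).2]
          exact bdry_mem_bdrySet _
    exact ⟨succ P qs p - p, norm_sub_eq_one_of_mem_nbrs (succ_mem_nbrs hqs),
      exists_pow_eq_of_tight hqs hts⟩
  -- a base point and its frame
  obtain ⟨p₀, hp₀⟩ := hne
  obtain ⟨u, hu, hu₀⟩ := hcoh p₀ hp₀
  refine ⟨u, p₀, hu, ?_⟩
  -- the centres already known to lie on the lattice with frame `u`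
  set G := P.filter fun p => (∃ a b : ℤ, p = p₀ + u * ((a : ℂ) + (b : ℂ) * ζ)) ∧
    ∀ k ∈ nbrs P p, ∃ j : ℕ, k - p = u * ζ ^ j with hG
  have hp₀G : p₀ ∈ G := Finset.mem_filter.2 ⟨hp₀, ⟨0, 0, by simp⟩, hu₀⟩
  have hclosed : ∀ p ∈ G, ∀ k ∈ nbrs P p, k ∈ G := by
    intro p hpG k hk
    obtain ⟨hpP, ⟨a, b, hab⟩, hdirs⟩ := Finset.mem_filter.1 hpG
    have hkP : k ∈ P := (mem_nbrs.1 hk).1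
    obtain ⟨j, hj⟩ := hdirs k hk
    obtain ⟨a', b', hab'⟩ := exists_exp_pi_div_three_mul_I_pow_eq j
    rw [← hζ] at hab'
    refine Finset.mem_filter.2 ⟨hkP, ⟨a + a', b + b', ?_⟩, ?_⟩
    · rw [hab'] at hj
      push_cast
      linear_combination hj + hab
    · obtain ⟨u', -, hdirs'⟩ := hcoh k hkP
      have hpk : p ∈ nbrs P k :=
        mem_nbrs.2 ⟨hpP, by rw [norm_sub_rev]; exact norm_sub_eq_one_of_mem_nbrs hk⟩
      obtain ⟨i₀, hi₀⟩ := hdirs' p hpk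
      have hu'eq : u' = u * ζ ^ (j + 3 + 5 * i₀) := by
        have e1 : u' = u' * ζ ^ i₀ * ζ ^ (5 * i₀) := by
          rw [mul_assoc, ← pow_add, show i₀ + 5 * i₀ = 6 * i₀ by ring, pow_mul, hz6, one_pow,
            mul_one]
        rw [e1, ← hi₀, show p - k = -(k - p) by ring, hj, pow_add, pow_add, hz3]
        ring
      intro k' hk'
      obtain ⟨i, hi⟩ := hdirs' k' hk'
      exact ⟨j + 3 + 5 * i₀ + i, by rw [hi, hu'eq, pow_add _ (j + 3 + 5 * i₀) i, mul_assoc]⟩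
  -- every centre is known (else the configuration splits)
  have hGP : G = P := by
    by_contra hGne
    apply hns
    have hGsub : G ⊆ P := Finset.filter_subset _ _
    refine Or.inl ⟨G, P \ G, ⟨p₀, hp₀G⟩, ?_, Finset.disjoint_sdiff,
      Finset.union_sdiff_of_subset hGsub, ?_⟩
    · rw [← Finset.card_pos, Finset.card_sdiff_of_subset hGsub]
      have := Finset.card_lt_card (lt_of_le_of_ne hGsub hGne)
      omega
    · intro a ha b hb hab
      have hb' : b ∈ nbrs P a := mem_nbrs.2 ⟨(Finset.mem_sdiff.1 hb).1, hab⟩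
      exact (Finset.mem_sdiff.1 hb).2 (hclosed a ha b hb')
  intro p hp
  rw [← hGP] at hp
  exact (Finset.mem_filter.1 hp).2.1

end Harborth

/-! ## §5 The named fact -/

open Complex Finset Harborth
open scoped Real

/-- **Heitmann–Radin 1980, Theorem (2)(a) (corollary form) holds**: all centres of a maximal
configuration of `N ≥ 3` unit discs lie on one congruent copy `A(A₂) + t` of the triangular
lattice. Discharge of `HeitmannRadin1980_groundStates`: transfer to centre sets in `ℂ` (as in
`HarborthContactNumberProof.lean`), maximality from Harborth's construction
(`exists_contactPairCount_eq_harborthNumber`), `tight_or_outer_of_maximal`,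
`exists_lattice_of_tight`, and the linear isometry `z ↦ u z` of `ℂ ≅ ℝ²`.
[cite: HeitmannRadin1980, Theorem (2)(a)] -/
theorem HeitmannRadin1980_groundStates_holds : HeitmannRadin1980_groundStates := by
  intro N hN x hx
  classical
  obtain ⟨hxhard, hxmax⟩ := hx
  -- move to `ℂ`
  let e : EuclideanSpace ℝ (Fin 2) ≃ₗᵢ[ℝ] ℂ := Complex.orthonormalBasisOneI.repr.symm
  let y : Fin N → ℂ := fun i => e (x i)
  have hdist : ∀ i j, dist (y i) (y j) = dist (x i) (x j) := fun i j => e.dist_map (x i) (x j)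
  have hyinj : Function.Injective y := by
    intro i j h
    by_contra hij
    have h1 : 1 ≤ dist (x i) (x j) := hxhard hij
    rw [← hdist, h, dist_self] at h1
    exact absurd h1 (by norm_num)
  let P : Finset ℂ := Finset.univ.image y
  have hmem : ∀ i, y i ∈ P := fun i => Finset.mem_image_of_mem y (Finset.mem_univ i)
  have hcard : P.card = N := by
    rw [Finset.card_image_of_injective _ hyinj, Finset.card_univ, Fintype.card_fin]
  have hhard : Harborth.IsHard P := by
    intro p hp q hq hpq
    obtain ⟨i, -, rfl⟩ := Finset.mem_image.1 hp
    obtain ⟨j, -, rfl⟩ := Finset.mem_image.1 hq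
    have hij : j ≠ i := fun h => hpq (by rw [h])
    rw [← dist_eq_norm, hdist]
    exact hxhard hij
  -- the centre set carries `2 · contactPairCount x` darts
  set A := Finset.univ.filter fun p : Fin N × Fin N => p.1 < p.2 ∧ dist (x p.1) (x p.2) = 1
    with hA
  have hAc : A.card = contactPairCount x := rfl
  let f : Fin N × Fin N → ℂ × ℂ := fun ij => (y ij.1, y ij.2)
  have hfinj : Function.Injective f := by
    intro a b h
    have h' := Prod.mk.inj h
    exact Prod.ext (hyinj h'.1) (hyinj h'.2)
  have hdisj : Disjoint A (A.image Prod.swap) := by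
    rw [Finset.disjoint_left]
    intro p hp hp'
    obtain ⟨q, hq, hqp⟩ := Finset.mem_image.1 hp'
    rw [hA, Finset.mem_filter] at hp hq
    rw [← hqp, Prod.fst_swap, Prod.snd_swap] at hp
    exact lt_asymm hp.2.1 hq.2.1
  have hsub : (A ∪ A.image Prod.swap).image f ⊆ Harborth.darts P := by
    intro d hd
    obtain ⟨p, hp, rfl⟩ := Finset.mem_image.1 hd
    have h1 : dist (x p.1) (x p.2) = 1 := by
      rcases Finset.mem_union.1 hp with h | h
      · exact (Finset.mem_filter.1 h).2.2
      · obtain ⟨q, hq, rfl⟩ := Finset.mem_image.1 h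
        rw [Prod.fst_swap, Prod.snd_swap, dist_comm]
        exact (Finset.mem_filter.1 hq).2.2
    refine Harborth.mem_darts.2 ⟨⟨hmem _, hmem _⟩, ?_⟩
    change ‖y p.2 - y p.1‖ = 1
    rw [← dist_eq_norm, hdist, dist_comm, h1]
  have h2c : 2 * contactPairCount x ≤ (Harborth.darts P).card := by
    calc 2 * contactPairCount x = (A ∪ A.image Prod.swap).card := by
          rw [Finset.card_union_of_disjoint hdisj,
            Finset.card_image_of_injective _ Prod.swap_injective, hAc]
          ring
      _ = ((A ∪ A.image Prod.swap).image f).card := (Finset.card_image_of_injective _ hfinj).symm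
      _ ≤ (Harborth.darts P).card := Finset.card_le_card hsub
  -- maximality: Harborth's construction has `[3N - √(12N-3)]` contacts, so `x` has at least as many
  obtain ⟨w, hw, hwN⟩ := exists_contactPairCount_eq_harborthNumber N
  have hge : harborthNumber N ≤ contactPairCount x := by
    rw [← hwN]; exact_mod_cast hxmax w hw
  have hmax : 2 * harborthNumber P.card ≤ ((Harborth.darts P).card : ℤ) := by
    rw [hcard]
    have : ((2 * contactPairCount x : ℕ) : ℤ) ≤ (Harborth.darts P).card := by exact_mod_cast h2c
    push_cast at this
    linarith
  -- the structure theorem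
  have h3 : 3 ≤ P.card := hcard ▸ hN
  have hns := not_splits_of_maximal hhard hmax
  have hne : P.Nonempty := Finset.card_pos.1 (by omega)
  have h2' : ∀ p ∈ P, 2 ≤ (nbrs P p).card := fun p hp => two_le_card_nbrs_of_not_splits h3 hns hp
  have htight := tight_or_outer_of_maximal P.card P hhard rfl h3 hmax hne h2'
  obtain ⟨u, t, hu, hlat⟩ := exists_lattice_of_tight hhard hns htight
  -- the isometry `z ↦ e⁻¹ (u · e z)`
  let M : ℂ →ₗ[ℝ] ℂ := LinearMap.mulLeft ℝ u
  have hM : ∀ z, ‖M z‖ = ‖z‖ := fun z => by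
    simp only [M, LinearMap.mulLeft_apply, norm_mul, hu, one_mul]
  let Mi : ℂ →ₗᵢ[ℝ] ℂ := ⟨M, hM⟩
  refine ⟨e.symm.toLinearIsometry.comp (Mi.comp e.toLinearIsometry), e.symm t, fun i => ?_⟩
  obtain ⟨a, b, hab⟩ := hlat (y i) (hmem i)
  refine ⟨(a, b), ?_⟩
  have htri : e (Literature.MathematicalPhysics.StatisticalMechanics.Theil2006.triPoint (a, b)) =
      (a : ℂ) + (b : ℂ) * Complex.exp (((π / 3 : ℝ) : ℂ) * I) := by
    rw [exp_pi_div_three_mul_I]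
    apply Complex.ext
    · simp [e, Complex.orthonormalBasisOneI_repr_symm_apply]
      ring
    · simp [e, Complex.orthonormalBasisOneI_repr_symm_apply]
      ring
  apply e.injective
  change y i = e (e.symm (M (e _)) + e.symm t)
  rw [map_add, e.apply_symm_apply, e.apply_symm_apply, LinearMap.mulLeft_apply, htri, hab, add_comm]

end Literature.Geometry.DiscreteGeometry

end
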